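import Summits.AtomisticToContinuum.FouriersLaw.Theses.EmbeddedDrudeMourre
import Summits.AtomisticToContinuum.FouriersLaw.Theses.StaticAbelianSqueeze
import Literature.Barriers.AtomisticToContinuum.HarmonicCrystalBallisticProofs

/-!
# `UniformAbelianRegularity` / Negative (1): the harmonic corner, linear-GK necessity, the two-scale family

Support file (`--supports stmt-AtomisticToContinuum-13416`) of the standing disprover seat of the crux
`EmbeddedDrudeMourre.UniformAbelianRegularity` (R) — `rfl`-identical to the `StaticAbelianSqueeze` copy
(`crux_eq_twin`) and to the `HoelderEscapeProfile` / `CoercivePulse` / `CageBudgetFekete` copies, so every lemma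
serves all five routes.  The crux is NOT refuted (it is, given the PROVED Kubo identity (K), Fourier's law for the
pinned quartic chain with matching open/closed constants); this file lands what is certain AROUND it, all
sorry-free, definition-free and notation-free (statements are spelled out; below, "c_N" always means the crux's
autocorrelation `t ↦ ∫ J·(P_t J) dμ_{N,T}`, `J = Σ_i bondCurrent N i`, `P_t = transitionKernel N T T t`, `μ = gibbsMeasure N T`):

* `false_without_epsPos` — the guard `0 < ε` is load-bearing (trivial; recorded so that no seat re-derives it).
* `gk_linear_of_abelRegular` — ABSTRACT CORE: the (R)-shape of the Abel deficits of a family `c N` plus a linear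
  equal-time bound `|c N t| ≤ B N` force `∫₀^∞ c N ≤ K N` eventually (where integrable): (R) ⟹ the UPPER half of
  bounded response, read through (K).  Ballistic or anomalous families violate (R).
* `harmonic_false_of` — **anharmonicity is load-bearing**: for EVERY `ω₂, γ, T > 0` the (R)-statement at the
  harmonic corner `lam = β = 0` is FALSE, modulo the `β = 0` instances of two facts that are LANDED for `β > 0`:
  the Kundu–Dhar–Narayan identity (consequent of `StaticAbelianSqueeze.KuboAbelIdentity`, PROVED
  `kuboAbelIdentity_holds`) and the equal-time bound (`stub_equalTimeBound`, p144650).  Engine: the PROVED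
  Rieder–Lebowitz–Lieb law `HarmonicChainBallisticFlux_holds` makes `∫₀^∞ c_{M+1} = M T² (M c_{M+1})` with
  `M c_{M+1} → +∞`, against the linear bound of `gk_linear_of_abelRegular`.  Corollary
  `false_without_anharmonicity_of`: the `lam, β ≥ 0` extension of the crux is false modulo the two facts at one point.
  So any proof of (R) must use `lam > 0 ∨ β > 0` essentially — by the scaling conjugacy
  (`LowTemperatureWeakAnharmonicity`) it cannot be temperature-uniform as `T → 0`.
* `exists_family_not_abelRegular` — the NATURAL STRENGTHENING IS FALSE: an explicit non-negative family
  (`N e^{−t} + N⁻¹ e^{−t/N²}`: microscopic part plus a slow component of amplitude `1/N` on the time-scale `N²`)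
  has the equal-time bound `≤ 2N`, is integrable for each `N` with the LINEAR Green–Kubo integral `2N` (bounded
  response), and has the pointwise bulk limit `c N t / N → e^{−t}`, yet its Abel deficit is `≥ N/2` once `ν N² ≥ 1`.
  Hence (equal-time bound ∧ fixed-`N` integrability ∧ bounded response ∧ pointwise bulk limit) ⇏ (R): the
  `N`-UNIFORM tail control (birth's `stub_uniformL1Tail`, the Sketch line's `PostCrossingSaturation` /
  exponential splice error) is the load-bearing input of every registered line, as their cards assert.

cdisprove seat refuter-cdisprove-stmt-AtomisticToContinuum-13416-0, cycle 1, 2026-08-17.  Work file with the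
near-misses and the line assessment: `Cruxes/UniformAbelianRegularity/Disproof.lean`.
-/

noncomputable section

namespace Summit.AtomisticToContinuum.FouriersLaw.Theorems.UniformAbelianRegularity.Negative

open MeasureTheory Filter Set Topology
open Literature.MathematicalPhysics.KineticTheory.HeatConduction
open Literature.Barriers.AtomisticToContinuum (HarmonicChainBallisticFlux HarmonicChainBallisticFlux_holds)
open Summit.AtomisticToContinuum.FouriersLaw.Theses

/-! ## §0 Read-back -/

/-- The route copies of the crux are one proposition (this route's and the skeleton's). [folklore] -/
theorem crux_eq_twin :
    EmbeddedDrudeMourre.UniformAbelianRegularity = StaticAbelianSqueeze.UniformAbelianRegularity :=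
  rfl

/-! ## §1 The guard `0 < ε` -/

/-- `0 < ε` is (trivially) load-bearing: with the guard deleted, `ε = −1` fails for `N ≥ 1`. [folklore] -/
theorem false_without_epsPos :
    ¬ ∀ ω₂ lam β γ : ℝ, 0 < ω₂ → 0 < lam → 0 < β → 0 < γ → ∀ T : ℝ, 0 < T → ∀ ε : ℝ,
        ∃ ν₀ : ℝ, 0 < ν₀ ∧ ∀ ν : ℝ, 0 < ν → ν < ν₀ → ∃ N₀ : ℕ, ∀ N : ℕ, N₀ ≤ N →
          |∫ t in Ioi (0:ℝ), (1 - Real.exp (-(ν * t))) *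
            (∫ z, (∑ i : Fin N, (pinnedChain ω₂ lam β γ).bondCurrent N i z) *
              (∫ y, (∑ i : Fin N, (pinnedChain ω₂ lam β γ).bondCurrent N i y)
                ∂((pinnedChain ω₂ lam β γ).transitionKernel N T T t.toNNReal z))
            ∂((pinnedChain ω₂ lam β γ).gibbsMeasure N T))| ≤ ε * N := by
  intro h
  obtain ⟨ν₀, hν₀, h⟩ := h 1 1 1 1 one_pos one_pos one_pos one_pos 1 one_pos (-1)
  obtain ⟨N₀, hN⟩ := h (ν₀ / 2) (by positivity) (by linarith)
  have h1 := (abs_nonneg _).trans (hN (N₀ + 1) (Nat.le_succ _))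
  have h2 : (0:ℝ) < ((N₀ + 1 : ℕ) : ℝ) := by positivity
  linarith

/-! ## §2 Abstract core: (R)-shape + equal-time bound ⟹ linear Green–Kubo integral -/

/-- Abel side is at most linear: `|∫ e^{−νt} c| ≤ B/ν` under `|c| ≤ B` on `(0, ∞)`. [folklore] -/
theorem abs_integral_exp_mul_le {c : ℝ → ℝ} {B ν : ℝ} (hν : 0 < ν)
    (hbd : ∀ t : ℝ, 0 < t → |c t| ≤ B) :
    |∫ t in Ioi (0:ℝ), Real.exp (-(ν * t)) * c t| ≤ B / ν := by
  have hexp : IntegrableOn (fun t : ℝ => Real.exp (-ν * t)) (Ioi 0) :=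
    integrableOn_exp_mul_Ioi (by linarith) 0
  have hg : IntegrableOn (fun t : ℝ => B * Real.exp (-ν * t)) (Ioi 0) := hexp.const_mul B
  have hle : ∀ᵐ t ∂(volume.restrict (Ioi (0:ℝ))),
      ‖Real.exp (-(ν * t)) * c t‖ ≤ B * Real.exp (-ν * t) := by
    refine (ae_restrict_iff' measurableSet_Ioi).2 (Eventually.of_forall fun t ht => ?_)
    rw [norm_mul, Real.norm_eq_abs, Real.norm_eq_abs, abs_of_pos (Real.exp_pos _), neg_mul, mul_comm]
    exact mul_le_mul_of_nonneg_right (hbd t ht) (Real.exp_pos _).le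
  have h1 := norm_integral_le_of_norm_le hg hle
  rw [Real.norm_eq_abs] at h1
  refine h1.trans (le_of_eq ?_)
  rw [integral_const_mul, integral_exp_mul_Ioi (by linarith : -ν < 0) 0]
  field_simp
  simp

/-- The Abelian split `∫ c = ∫ e^{−νt} c + ∫ (1 − e^{−νt}) c` for `c ∈ L¹(0,∞)`. [folklore] -/
theorem integral_split_abel (c : ℝ → ℝ) {ν : ℝ} (hν : 0 < ν) (hc : IntegrableOn c (Ioi 0)) :
    ∫ t in Ioi (0:ℝ), c t = (∫ t in Ioi (0:ℝ), Real.exp (-(ν * t)) * c t) +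
      ∫ t in Ioi (0:ℝ), (1 - Real.exp (-(ν * t))) * c t := by
  have hcont : Continuous fun t : ℝ => Real.exp (-(ν * t)) := by fun_prop
  have hcont' : Continuous fun t : ℝ => 1 - Real.exp (-(ν * t)) := by fun_prop
  have hle : ∀ t : ℝ, t ∈ Ioi (0:ℝ) → Real.exp (-(ν * t)) ≤ 1 := fun t ht =>
    Real.exp_le_one_iff.2 (by have : 0 ≤ ν * t := mul_nonneg hν.le (le_of_lt ht); linarith)
  have h1 : IntegrableOn (fun t => Real.exp (-(ν * t)) * c t) (Ioi 0) := by
    refine Integrable.mono hc (hcont.aestronglyMeasurable.mul hc.aestronglyMeasurable) ?_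
    refine (ae_restrict_iff' measurableSet_Ioi).2 (Eventually.of_forall fun t ht => ?_)
    rw [norm_mul, Real.norm_eq_abs, abs_of_pos (Real.exp_pos _)]
    exact mul_le_of_le_one_left (norm_nonneg _) (hle t ht)
  have h2 : IntegrableOn (fun t => (1 - Real.exp (-(ν * t))) * c t) (Ioi 0) := by
    refine Integrable.mono hc (hcont'.aestronglyMeasurable.mul hc.aestronglyMeasurable) ?_
    refine (ae_restrict_iff' measurableSet_Ioi).2 (Eventually.of_forall fun t ht => ?_)
    have h0 : 0 ≤ 1 - Real.exp (-(ν * t)) := by linarith [hle t ht]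
    have h1' : 1 - Real.exp (-(ν * t)) ≤ 1 := by linarith [Real.exp_pos (-(ν * t))]
    rw [norm_mul, Real.norm_eq_abs, abs_of_nonneg h0]
    exact mul_le_of_le_one_left (norm_nonneg _) h1'
  calc ∫ t in Ioi (0:ℝ), c t
      = ∫ t in Ioi (0:ℝ), (Real.exp (-(ν * t)) * c t + (1 - Real.exp (-(ν * t))) * c t) := by
        congr 1; funext t; ring
    _ = (∫ t in Ioi (0:ℝ), Real.exp (-(ν * t)) * c t) +
          ∫ t in Ioi (0:ℝ), (1 - Real.exp (-(ν * t))) * c t := integral_add h1 h2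

/-- **ABSTRACT CORE.**  If the Abel deficits `∫ (1 − e^{−νt}) c N t` of a family have the (R)-shape and
`|c N t| ≤ B N` on `(0,∞)`, then for some `K` and eventually in `N`: `c N ∈ L¹(0,∞) ⟹ ∫₀^∞ c N ≤ K N`.
Proof: (R) at `ε = 1`, `ν = ν₀/2`, the split and `|∫ e^{−νt} c N| ≤ B N/ν`. [folklore] -/
theorem gk_linear_of_abelRegular (c : ℕ → ℝ → ℝ) {B : ℝ}
    (hbd : ∀ (N : ℕ) (t : ℝ), 0 < t → |c N t| ≤ B * N)
    (hR : ∀ ε : ℝ, 0 < ε → ∃ ν₀ : ℝ, 0 < ν₀ ∧ ∀ ν : ℝ, 0 < ν → ν < ν₀ → ∃ N₀ : ℕ, ∀ N : ℕ, N₀ ≤ N →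
      |∫ t in Ioi (0:ℝ), (1 - Real.exp (-(ν * t))) * c N t| ≤ ε * N) :
    ∃ K : ℝ, ∃ N₀ : ℕ, ∀ N : ℕ, N₀ ≤ N → IntegrableOn (c N) (Ioi 0) →
      ∫ t in Ioi (0:ℝ), c N t ≤ K * N := by
  obtain ⟨ν₀, hν₀, hRν⟩ := hR 1 one_pos
  have hν : 0 < ν₀ / 2 := by positivity
  obtain ⟨N₀, hN₀⟩ := hRν (ν₀ / 2) hν (by linarith)
  refine ⟨1 + B / (ν₀ / 2), N₀, fun N hN hint => ?_⟩
  have hsplit := integral_split_abel (c N) hν hint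
  have hA := abs_integral_exp_mul_le (c := c N) hν (hbd N)
  have hS := hN₀ N hN
  have hA' := (le_abs_self _).trans hA
  have hS' := (le_abs_self _).trans hS
  rw [hsplit]
  have : B * ↑N / (ν₀ / 2) = B / (ν₀ / 2) * N := by ring
  nlinarith [hA', hS', this]

/-! ## §3 The harmonic corner `lam = β = 0` -/

/-- **Anharmonicity is load-bearing: (R) FAILS at the harmonic corner**, for every `ω₂, γ, T > 0`.  Stated for
an arbitrary family `c N t` standing for the HARMONIC chain's autocorrelation `c_N(t)` at `(ω₂, 0, 0, γ, T)` (apply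
it with `c := fun N t => ∫ J·(P_t J) dμ_{N,T}` of `pinnedChain ω₂ 0 0 γ`), modulo the `lam = β = 0` instances of two
facts LANDED for `β > 0`: `hK` — the Kundu–Dhar–Narayan identity `c_N ∈ L¹(0,∞) ∧ (N−1)T²D_N = ∫₀^∞ c_N` along
steady families of `pinnedChain ω₂ 0 0 γ` (consequent of `StaticAbelianSqueeze.KuboAbelIdentity`, PROVED
`kuboAbelIdentity_holds`; true in print at the corner, where the weak steady state is the unique Gaussian one), and
`hE` — the `N`-linear equal-time bound (`stub_equalTimeBound`, p144650; at the corner `Var_μ(J) ≤ 3MN` and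
Cauchy–Schwarz with stationarity).  Proof: along the Rieder–Lebowitz–Lieb steady family of the PROVED
`HarmonicChainBallisticFlux_holds` the `(M+1)`-chain has response `M c_{M+1}` with `M c_{M+1} → +∞`; `hK` turns this
into `∫₀^∞ c_{M+1} = M T² (M c_{M+1})`, quadratic in `M`, against `gk_linear_of_abelRegular`.  Consequently no proof
of (R) can consist of steps insensitive to `(lam, β)`; by the scaling conjugacy it cannot be `T`-uniform as
`T → 0` (barrier `LowTemperatureWeakAnharmonicity`). [cite: RoyDhar2008, §2 eqs. (2.2) and (2.8)] -/
theorem harmonic_false_of {ω₂ γ T : ℝ} (hω : 0 < ω₂) (hγ : 0 < γ) (hT : 0 < T) (c : ℕ → ℝ → ℝ)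
    (hK : ∀ μ : (N : ℕ) → ℝ → ℝ → Measure (PhaseSpace N),
      (∀ (N : ℕ) (T_L T_R : ℝ), 0 < T_L → 0 < T_R →
        (pinnedChain ω₂ 0 0 γ).IsSteadyState N T_L T_R (μ N T_L T_R)) →
      ∀ N : ℕ, ∀ D : ℝ,
        Tendsto (fun δ : ℝ => (pinnedChain ω₂ 0 0 γ).totalCurrent (μ N (T + δ / 2) (T - δ / 2)) / δ)
          (𝓝[≠] 0) (𝓝 D) →
        IntegrableOn (c N) (Ioi 0) ∧ ((N:ℝ) - 1) * T ^ 2 * D = ∫ t in Ioi (0:ℝ), c N t)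
    (hE : ∃ C : ℝ, ∀ (N : ℕ) (t : ℝ), 0 < t → |c N t| ≤ C * N) :
    ¬ ∀ ε : ℝ, 0 < ε → ∃ ν₀ : ℝ, 0 < ν₀ ∧ ∀ ν : ℝ, 0 < ν → ν < ν₀ → ∃ N₀ : ℕ, ∀ N : ℕ, N₀ ≤ N →
        |∫ t in Ioi (0:ℝ), (1 - Real.exp (-(ν * t))) * c N t| ≤ ε * N := by
  intro hR
  obtain ⟨μ, hμ, a, ainf, -, hresp, -, hup⟩ :=
    HarmonicChainBallisticFlux.ballisticLaw HarmonicChainBallisticFlux_holds hω hγ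
  obtain ⟨C, hC⟩ := hE
  obtain ⟨K, N₀, hlin⟩ := gk_linear_of_abelRegular c hC hR
  have hGK : ∀ M : ℕ, IntegrableOn (c (M + 1)) (Ioi 0) ∧
      (M:ℝ) * T ^ 2 * ((M:ℝ) * a (M + 1)) = ∫ t in Ioi (0:ℝ), c (M + 1) t := by
    intro M
    have h := hK μ hμ (M + 1) ((M:ℝ) * a (M + 1)) (hresp T hT M)
    refine ⟨h.1, ?_⟩
    have e : (((M + 1 : ℕ) : ℝ) - 1) = (M:ℝ) := by push_cast; ring
    rw [← h.2, e]
  have hev1 : ∀ᶠ M : ℕ in atTop, (2 * |K| + 1) / T ^ 2 ≤ (M:ℝ) * a (M + 1) :=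
    hup.eventually (eventually_ge_atTop _)
  obtain ⟨M, h1, h2, h3⟩ := (hev1.and ((eventually_ge_atTop N₀).and (eventually_ge_atTop 1))).exists
  obtain ⟨hint, hval⟩ := hGK M
  have hle := hlin (M + 1) (by omega) hint
  rw [← hval] at hle
  have hT2 : 0 < T ^ 2 := by positivity
  have hMc : 2 * |K| + 1 ≤ (M:ℝ) * a (M + 1) * T ^ 2 := by rwa [div_le_iff₀ hT2] at h1
  have hM1 : (1:ℝ) ≤ M := by exact_mod_cast h3
  have key : (M:ℝ) * (2 * |K| + 1) ≤ (M:ℝ) * T ^ 2 * ((M:ℝ) * a (M + 1)) := by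
    have := mul_le_mul_of_nonneg_left hMc (by positivity : (0:ℝ) ≤ M)
    linarith [this]
  have hcast : ((M + 1 : ℕ) : ℝ) = (M:ℝ) + 1 := by push_cast; ring
  rw [hcast] at hle
  nlinarith [key, hle, le_abs_self K, hM1, abs_nonneg K]

/-- **Corollary, on the crux's own objects: the `lam, β ≥ 0` extension of `UniformAbelianRegularity` is FALSE**,
modulo the two harmonic-corner facts (`hK`: KDN identity along steady families; `hE`: equal-time bound) for the
equilibrium autocorrelation of `pinnedChain 1 0 0 1` at `T = 1`. [folklore] -/
theorem false_without_anharmonicity_of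
    (hK : ∀ μ : (N : ℕ) → ℝ → ℝ → Measure (PhaseSpace N),
      (∀ (N : ℕ) (T_L T_R : ℝ), 0 < T_L → 0 < T_R →
        (pinnedChain 1 0 0 1).IsSteadyState N T_L T_R (μ N T_L T_R)) →
      ∀ N : ℕ, ∀ D : ℝ,
        Tendsto (fun δ : ℝ => (pinnedChain 1 0 0 1).totalCurrent (μ N (1 + δ / 2) (1 - δ / 2)) / δ)
          (𝓝[≠] 0) (𝓝 D) →
        IntegrableOn (fun t : ℝ =>
            (∫ z, (∑ i : Fin N, (pinnedChain 1 0 0 1).bondCurrent N i z) *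
              (∫ y, (∑ i : Fin N, (pinnedChain 1 0 0 1).bondCurrent N i y)
                ∂((pinnedChain 1 0 0 1).transitionKernel N 1 1 t.toNNReal z))
            ∂((pinnedChain 1 0 0 1).gibbsMeasure N 1))) (Ioi 0) ∧
          ((N:ℝ) - 1) * (1:ℝ) ^ 2 * D = ∫ t in Ioi (0:ℝ),
            (∫ z, (∑ i : Fin N, (pinnedChain 1 0 0 1).bondCurrent N i z) *
              (∫ y, (∑ i : Fin N, (pinnedChain 1 0 0 1).bondCurrent N i y)
                ∂((pinnedChain 1 0 0 1).transitionKernel N 1 1 t.toNNReal z))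
            ∂((pinnedChain 1 0 0 1).gibbsMeasure N 1)))
    (hE : ∃ C : ℝ, ∀ (N : ℕ) (t : ℝ), 0 < t →
      |(∫ z, (∑ i : Fin N, (pinnedChain 1 0 0 1).bondCurrent N i z) *
              (∫ y, (∑ i : Fin N, (pinnedChain 1 0 0 1).bondCurrent N i y)
                ∂((pinnedChain 1 0 0 1).transitionKernel N 1 1 t.toNNReal z))
            ∂((pinnedChain 1 0 0 1).gibbsMeasure N 1))| ≤ C * N) :
    ¬ ∀ ω₂ lam β γ : ℝ, 0 < ω₂ → 0 ≤ lam → 0 ≤ β → 0 < γ → ∀ T : ℝ, 0 < T → ∀ ε : ℝ, 0 < ε →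
        ∃ ν₀ : ℝ, 0 < ν₀ ∧ ∀ ν : ℝ, 0 < ν → ν < ν₀ → ∃ N₀ : ℕ, ∀ N : ℕ, N₀ ≤ N →
          |∫ t in Ioi (0:ℝ), (1 - Real.exp (-(ν * t))) *
            (∫ z, (∑ i : Fin N, (pinnedChain ω₂ lam β γ).bondCurrent N i z) *
              (∫ y, (∑ i : Fin N, (pinnedChain ω₂ lam β γ).bondCurrent N i y)
                ∂((pinnedChain ω₂ lam β γ).transitionKernel N T T t.toNNReal z))
            ∂((pinnedChain ω₂ lam β γ).gibbsMeasure N T))| ≤ ε * N :=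
  fun h => harmonic_false_of one_pos one_pos one_pos
    (fun N t => (∫ z, (∑ i : Fin N, (pinnedChain 1 0 0 1).bondCurrent N i z) *
              (∫ y, (∑ i : Fin N, (pinnedChain 1 0 0 1).bondCurrent N i y)
                ∂((pinnedChain 1 0 0 1).transitionKernel N 1 1 t.toNNReal z))
            ∂((pinnedChain 1 0 0 1).gibbsMeasure N 1)))
    hK hE (h 1 0 0 1 one_pos le_rfl le_rfl one_pos 1 one_pos)

/-! ## §4 The natural strengthening is false: a two-scale family -/

/-- `∫_{t>0} e^{−a t} = 1/a` with integrability, in the `-(a * t)` spelling of the crux. [folklore] -/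
theorem integral_exp_neg_mul {a : ℝ} (ha : 0 < a) :
    IntegrableOn (fun t : ℝ => Real.exp (-(a * t))) (Ioi 0) ∧ ∫ t in Ioi (0:ℝ), Real.exp (-(a * t)) = 1 / a := by
  have e : (fun t : ℝ => Real.exp (-(a * t))) = fun t => Real.exp (-a * t) := by
    funext t; rw [neg_mul]
  rw [e]
  refine ⟨integrableOn_exp_mul_Ioi (by linarith) 0, ?_⟩
  rw [integral_exp_mul_Ioi (by linarith : -a < 0) 0]
  simp [div_neg, neg_div]

/-- Closed forms for the two-scale family `N e^{−t} + N⁻¹ e^{−t/N²}` (`N ≥ 1`, `ν > 0`): integrability,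
Green–Kubo integral `2N`, and Abel deficit `N(1 − 1/(1+ν)) + N⁻¹(N² − 1/(N⁻² + ν))`. [folklore] -/
theorem twoScale_closedForms {N : ℕ} (hN : 1 ≤ N) {ν : ℝ} (hν : 0 < ν) :
    IntegrableOn (fun t : ℝ => (N:ℝ) * Real.exp (-t) + (N:ℝ)⁻¹ * Real.exp (-((N:ℝ)^2)⁻¹ * t)) (Ioi 0) ∧
    (∫ t in Ioi (0:ℝ), ((N:ℝ) * Real.exp (-t) + (N:ℝ)⁻¹ * Real.exp (-((N:ℝ)^2)⁻¹ * t))) = 2 * N ∧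
    ∫ t in Ioi (0:ℝ), (1 - Real.exp (-(ν * t))) *
        ((N:ℝ) * Real.exp (-t) + (N:ℝ)⁻¹ * Real.exp (-((N:ℝ)^2)⁻¹ * t)) =
      (N:ℝ) * (1 - 1 / (1 + ν)) + (N:ℝ)⁻¹ * ((N:ℝ) ^ 2 - 1 / (((N:ℝ)^2)⁻¹ + ν)) := by
  have hN' : (0:ℝ) < N := by exact_mod_cast hN
  have hN2 : (0:ℝ) < ((N:ℝ)^2)⁻¹ := by positivity
  obtain ⟨i1, v1⟩ := integral_exp_neg_mul one_pos
  obtain ⟨i2, v2⟩ := integral_exp_neg_mul (by linarith : (0:ℝ) < 1 + ν)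
  obtain ⟨i3, v3⟩ := integral_exp_neg_mul hN2
  obtain ⟨i4, v4⟩ := integral_exp_neg_mul (by linarith : (0:ℝ) < ((N:ℝ)^2)⁻¹ + ν)
  have hts : (fun t : ℝ => (N:ℝ) * Real.exp (-t) + (N:ℝ)⁻¹ * Real.exp (-((N:ℝ)^2)⁻¹ * t)) =
      fun t => (N:ℝ) * Real.exp (-(1 * t)) + (N:ℝ)⁻¹ * Real.exp (-(((N:ℝ)^2)⁻¹ * t)) := by
    funext t; simp [neg_mul]
  have h1 : Integrable (fun t : ℝ => (N:ℝ) * Real.exp (-(1 * t))) (volume.restrict (Ioi 0)) :=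
    i1.const_mul _
  have h2 : Integrable (fun t : ℝ => (N:ℝ) * Real.exp (-((1 + ν) * t))) (volume.restrict (Ioi 0)) :=
    i2.const_mul _
  have h3 : Integrable (fun t : ℝ => (N:ℝ)⁻¹ * Real.exp (-(((N:ℝ)^2)⁻¹ * t))) (volume.restrict (Ioi 0)) :=
    i3.const_mul _
  have h4 : Integrable (fun t : ℝ => (N:ℝ)⁻¹ * Real.exp (-((((N:ℝ)^2)⁻¹ + ν) * t)))
      (volume.restrict (Ioi 0)) :=
    i4.const_mul _
  have hone : (1 : ℝ) / ((N:ℝ)^2)⁻¹ = (N:ℝ)^2 := by field_simp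
  refine ⟨?_, ?_, ?_⟩
  · rw [hts]; exact h1.add h3
  · have hinv : (N:ℝ)⁻¹ * (N:ℝ) ^ 2 = N := by
      rw [pow_two, ← mul_assoc, inv_mul_cancel₀ hN'.ne', one_mul]
    rw [hts, integral_add h1 h3, integral_const_mul, integral_const_mul, v1, v3, hone, hinv]
    ring
  have hexp : ∀ a t : ℝ, Real.exp (-(ν * t)) * Real.exp (-(a * t)) = Real.exp (-((a + ν) * t)) := by
    intro a t; rw [← Real.exp_add]; congr 1; ring
  have hptw : (fun t => (1 - Real.exp (-(ν * t))) *
      ((N:ℝ) * Real.exp (-t) + (N:ℝ)⁻¹ * Real.exp (-((N:ℝ)^2)⁻¹ * t))) = fun t =>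
      ((N:ℝ) * Real.exp (-(1 * t)) - (N:ℝ) * Real.exp (-((1 + ν) * t))) +
        ((N:ℝ)⁻¹ * Real.exp (-(((N:ℝ)^2)⁻¹ * t)) - (N:ℝ)⁻¹ * Real.exp (-((((N:ℝ)^2)⁻¹ + ν) * t))) := by
    funext t
    have e1 : Real.exp (-t) = Real.exp (-(1 * t)) := by rw [one_mul]
    have e2 : Real.exp (-((N:ℝ)^2)⁻¹ * t) = Real.exp (-(((N:ℝ)^2)⁻¹ * t)) := by rw [neg_mul]
    rw [e1, e2, ← hexp 1 t, ← hexp (((N:ℝ)^2)⁻¹) t]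
    ring
  have h12 : Integrable (fun t : ℝ => (N:ℝ) * Real.exp (-(1 * t)) - (N:ℝ) * Real.exp (-((1 + ν) * t)))
      (volume.restrict (Ioi 0)) :=
    h1.sub h2
  have h34 : Integrable (fun t : ℝ => (N:ℝ)⁻¹ * Real.exp (-(((N:ℝ)^2)⁻¹ * t)) -
      (N:ℝ)⁻¹ * Real.exp (-((((N:ℝ)^2)⁻¹ + ν) * t))) (volume.restrict (Ioi 0)) :=
    h3.sub h4
  rw [hptw, integral_add h12 h34, integral_sub h1 h2, integral_sub h3 h4,
    integral_const_mul, integral_const_mul, integral_const_mul, integral_const_mul, v1, v2, v3, v4, hone]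
  ring

/-- **THE NATURAL STRENGTHENING IS FALSE.**  There is a non-negative family `c N t` with the equal-time bound
`c N t ≤ 2N` (`t ≥ 0`), integrable on `(0,∞)` for every `N ≥ 1` with the LINEAR Green–Kubo integral
`∫₀^∞ c N = 2N`, and with the pointwise bulk limit `c N t / N → e^{−t}`, whose Abel deficits do NOT have the
(R)-shape (they are `≥ N/2` whenever `ν N² ≥ 1`).  Witness: `c N t = N e^{−t} + N⁻¹ e^{−t/N²}` (a sum of
`e^{−a|t|}`, hence also positive-definite).  So the four listed properties do not imply (R); what (R) adds is
N-UNIFORM control of where in time the Green–Kubo weight sits. [folklore] -/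
theorem exists_family_not_abelRegular :
    ∃ c : ℕ → ℝ → ℝ,
      (∀ (N : ℕ) (t : ℝ), 0 ≤ c N t) ∧
      (∀ N : ℕ, 1 ≤ N → ∀ t : ℝ, 0 ≤ t → c N t ≤ 2 * N) ∧
      (∀ N : ℕ, 1 ≤ N → IntegrableOn (c N) (Ioi 0) ∧ ∫ t in Ioi (0:ℝ), c N t = 2 * N) ∧
      (∀ t : ℝ, 0 ≤ t → Tendsto (fun N : ℕ => c N t / N) atTop (𝓝 (Real.exp (-t)))) ∧
      ¬ ∀ ε : ℝ, 0 < ε → ∃ ν₀ : ℝ, 0 < ν₀ ∧ ∀ ν : ℝ, 0 < ν → ν < ν₀ → ∃ N₀ : ℕ, ∀ N : ℕ, N₀ ≤ N →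
          |∫ t in Ioi (0:ℝ), (1 - Real.exp (-(ν * t))) * c N t| ≤ ε * N := by
  refine ⟨fun N t => (N:ℝ) * Real.exp (-t) + (N:ℝ)⁻¹ * Real.exp (-((N:ℝ)^2)⁻¹ * t),
    fun N t => by positivity, ?_, ?_, ?_, ?_⟩
  · -- equal-time bound
    intro N hN t ht
    have hN' : (1:ℝ) ≤ N := by exact_mod_cast hN
    have h1 : Real.exp (-t) ≤ 1 := Real.exp_le_one_iff.2 (by linarith)
    have h2 : Real.exp (-((N:ℝ)^2)⁻¹ * t) ≤ 1 :=
      Real.exp_le_one_iff.2 (by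
        have : 0 ≤ ((N:ℝ)^2)⁻¹ * t := by positivity
        linarith)
    have h3 : (N:ℝ)⁻¹ ≤ 1 := inv_le_one_of_one_le₀ hN'
    have e1 : (N:ℝ) * Real.exp (-t) ≤ N := mul_le_of_le_one_right (by positivity) h1
    have e2 : (N:ℝ)⁻¹ * Real.exp (-((N:ℝ)^2)⁻¹ * t) ≤ 1 := by
      calc (N:ℝ)⁻¹ * Real.exp (-((N:ℝ)^2)⁻¹ * t) ≤ 1 * 1 :=
            mul_le_mul h3 h2 (Real.exp_pos _).le zero_le_one
        _ = 1 := by ring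
    show (N:ℝ) * Real.exp (-t) + (N:ℝ)⁻¹ * Real.exp (-((N:ℝ)^2)⁻¹ * t) ≤ 2 * N
    linarith
  · -- integrability and the linear Green–Kubo integral
    intro N hN
    obtain ⟨hi, hv, -⟩ := twoScale_closedForms hN one_pos
    exact ⟨hi, hv⟩
  · -- pointwise bulk limit
    intro t ht
    have hlim0 : Tendsto (fun N : ℕ => ((N:ℝ)^2)⁻¹) atTop (𝓝 0) :=
      tendsto_inv_atTop_zero.comp ((tendsto_pow_atTop two_ne_zero).comp tendsto_natCast_atTop_atTop)
    have hsmall : Tendsto (fun N : ℕ => ((N:ℝ)^2)⁻¹ * Real.exp (-((N:ℝ)^2)⁻¹ * t)) atTop (𝓝 0) := by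
      refine squeeze_zero (fun N => by positivity) (fun N => ?_) hlim0
      have h2 : Real.exp (-((N:ℝ)^2)⁻¹ * t) ≤ 1 :=
        Real.exp_le_one_iff.2 (by
          have : 0 ≤ ((N:ℝ)^2)⁻¹ * t := by positivity
          linarith)
      exact mul_le_of_le_one_right (by positivity) h2
    have hsum := (tendsto_const_nhds (x := Real.exp (-t))).add hsmall
    rw [add_zero] at hsum
    refine hsum.congr' ?_
    filter_upwards [eventually_ge_atTop 1] with N hN
    have hN' : (N:ℝ) ≠ 0 := by
      have : (1:ℝ) ≤ N := by exact_mod_cast hN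
      positivity
    field_simp
  · -- the Abel deficit is ≥ N/2 once ν N² ≥ 1
    intro hR
    obtain ⟨ν₀, hν₀, hRν⟩ := hR (1 / 4) (by norm_num)
    set ν := min (ν₀ / 2) 1 with hν_def
    have hν : 0 < ν := lt_min (by positivity) one_pos
    have hνlt : ν < ν₀ := (min_le_left _ _).trans_lt (by linarith)
    obtain ⟨N₀, hN₀⟩ := hRν ν hν hνlt
    obtain ⟨N, hNge⟩ := exists_nat_ge (max (N₀ : ℝ) (1 / ν + 1))
    have hN0 : (N₀ : ℝ) ≤ N := (le_max_left _ _).trans hNge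
    have hN0' : N₀ ≤ N := by exact_mod_cast hN0
    have hNν : 1 / ν + 1 ≤ (N:ℝ) := (le_max_right _ _).trans hNge
    have h1ν : 0 < 1 / ν := by positivity
    have hN1r : (1:ℝ) ≤ N := by linarith
    have hN1 : 1 ≤ N := by exact_mod_cast hN1r
    have hS := hN₀ N hN0'
    obtain ⟨-, -, hval⟩ := twoScale_closedForms hN1 hν
    simp only at hS
    rw [hval] at hS
    have hS' := (le_abs_self _).trans hS
    have hNpos : (0:ℝ) < N := by linarith
    have hA : 0 ≤ (N:ℝ) * (1 - 1 / (1 + ν)) := by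
      apply mul_nonneg hNpos.le
      rw [sub_nonneg, div_le_one (by linarith)]; linarith
    have hνN : 1 ≤ ν * (N:ℝ)^2 := by
      have h1 : 1 / ν ≤ N := by linarith
      have h2 : 1 ≤ ν * N := by rwa [div_le_iff₀' hν] at h1
      nlinarith
    have hB : (N:ℝ) / 2 ≤ (N:ℝ)⁻¹ * ((N:ℝ) ^ 2 - 1 / (((N:ℝ)^2)⁻¹ + ν)) := by
      have hden : 0 < ((N:ℝ)^2)⁻¹ + ν := by positivity
      have hfrac : 1 / (((N:ℝ)^2)⁻¹ + ν) ≤ (N:ℝ)^2 / 2 := by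
        rw [div_le_div_iff₀ hden (by norm_num : (0:ℝ) < 2)]
        have : ((N:ℝ)^2)⁻¹ * (N:ℝ)^2 = 1 := by field_simp
        nlinarith [this]
      calc (N:ℝ) / 2 = (N:ℝ)⁻¹ * ((N:ℝ)^2 - (N:ℝ)^2 / 2) := by field_simp; ring
        _ ≤ (N:ℝ)⁻¹ * ((N:ℝ) ^ 2 - 1 / (((N:ℝ)^2)⁻¹ + ν)) := by
            apply mul_le_mul_of_nonneg_left _ (by positivity)
            linarith
    linarith

end Summit.AtomisticToContinuum.FouriersLaw.Theorems.UniformAbelianRegularity.Negative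

end
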